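import Summits.MatrixMultiplication.OmegaCensus.DominoZ17StructSixPairsC1
import Summits.MatrixMultiplication.OmegaCensus.DominoZ17StructSixPairsC2
import Summits.MatrixMultiplication.OmegaCensus.DominoZ17StructSixPairsC3
import Summits.MatrixMultiplication.OmegaCensus.DominoZ17StructSixPairsC4
import Summits.MatrixMultiplication.OmegaCensus.DominoZ17StructSixPairsC5
import Summits.MatrixMultiplication.OmegaCensus.DominoZ17StructSixPairsC6
import Summits.MatrixMultiplication.OmegaCensus.DominoZ17StructSixPairsC7
import Summits.MatrixMultiplication.OmegaCensus.DominoZ17StructSixPairsC8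
import Summits.MatrixMultiplication.OmegaCensus.DominoZ17StructSixPairsC9
import Summits.MatrixMultiplication.OmegaCensus.DominoZ17StructSixPairsC10
import Summits.MatrixMultiplication.OmegaCensus.DominoZ17StructSixPairsC11
import Summits.MatrixMultiplication.OmegaCensus.DominoZ17StructSixPairsC12
import Summits.MatrixMultiplication.OmegaCensus.DominoZ17StructSixPairsC13
import Summits.MatrixMultiplication.OmegaCensus.DominoZ17StructSixPairsC14
import Summits.MatrixMultiplication.OmegaCensus.DominoZ17StructSixPairsC15
import HarnessLib

/-!
# The pair checks of family `c` (distinct directions) for the structural part-`6` route, `p = 17`: assembly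

ω-census `pub-omega`, family (b3), seat pub-omega-group gen 25.  Framing: lottery ticket; floor = certified bounds/negative
ranges.  VALUE: per-prime kernel data of the structural part-`6` route WITHOUT the pigeonhole (`DominoZpZpStructSixWide*.lean`)
for `p = 17` — target: the OPEN census cell `(1,6,16)@289` (`A = ℤ₁₇²`) and every larger order with such a quotient; NOT progress on ω.

`checkH6c_17` = hypothesis `h3c` of `exists_goodS_wide` from the 69 per-representative decides of the part files.
-/

namespace Summit.MatrixMultiplication.OmegaCensus

open ZpZpDomino

namespace ZpZpDomino

/-- **The pair check of family `c` over all representatives.** [folklore] -/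
theorem checkH6c_17 : ∀ k ∈ rZ17s6, checkH6c 17 etZ17s6 yscZ17s6 k = true := by
  simp only [rZ17s6, List.forall_mem_cons]
  exact ⟨checkH6c_17_0, checkH6c_17_1, checkH6c_17_2, checkH6c_17_3, checkH6c_17_4, checkH6c_17_5, checkH6c_17_6, checkH6c_17_7, checkH6c_17_8, checkH6c_17_9, checkH6c_17_10, checkH6c_17_11, checkH6c_17_12, checkH6c_17_13, checkH6c_17_14, checkH6c_17_15, checkH6c_17_16, checkH6c_17_17, checkH6c_17_18, checkH6c_17_19, checkH6c_17_20, checkH6c_17_21, checkH6c_17_22, checkH6c_17_23, checkH6c_17_24, checkH6c_17_25, checkH6c_17_26, checkH6c_17_27, checkH6c_17_28, checkH6c_17_29, checkH6c_17_30, checkH6c_17_31, checkH6c_17_32, checkH6c_17_33, checkH6c_17_34, checkH6c_17_35, checkH6c_17_36, checkH6c_17_37, checkH6c_17_38, checkH6c_17_39, checkH6c_17_40, checkH6c_17_41, checkH6c_17_42, checkH6c_17_43, checkH6c_17_44, checkH6c_17_45, checkH6c_17_46, checkH6c_17_47, checkH6c_17_48, checkH6c_17_49, checkH6c_17_50, checkH6c_17_51,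 checkH6c_17_52, checkH6c_17_53, checkH6c_17_54, checkH6c_17_55, checkH6c_17_56, checkH6c_17_57, checkH6c_17_58, checkH6c_17_59, checkH6c_17_60, checkH6c_17_61, checkH6c_17_62, checkH6c_17_63, checkH6c_17_64, checkH6c_17_65, checkH6c_17_66, checkH6c_17_67, checkH6c_17_68, fun _ h => (List.not_mem_nil h).elim⟩

end ZpZpDomino

end Summit.MatrixMultiplication.OmegaCensus
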